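import Literature.AlgebraicGeometry.HodgeTheory.FermatCoordinateSection
import Literature.AlgebraicGeometry.HodgeTheory.FermatZeroPoints
import Literature.AlgebraicGeometry.HodgeTheory.ThomGysinClosedImmersion
import HarnessLib

/-!
# The complex points of a coordinate hyperplane section of the Fermat variety: a taut closed copy of `Xⁿₘ(ℂ)` in `Xⁿ⁺¹ₘ(ℂ)`

Family `hodge`, layer `Literature/AlgebraicGeometry/HodgeTheory`. PROOF FILE (theorems only; no
definition, no named fact, D-0026). For the standard Fermat variety `Xⁿ⁺¹ₘ : Σ xᵢᵐ = 0` in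
`ℙⁿ⁺²` and the coordinate hyperplane section `Z_k = {x_k = 0} ∩ Xⁿ⁺¹ₘ ≅ Xⁿₘ` (Shioda, Math. Ann.
245 (1979) §1; Ran, Compositio Math. 42 (1980) §1 Lemma 1.4), the subset of complex points
`Z_k(ℂ) = {P ∈ Xⁿ⁺¹ₘ(ℂ) | pt P ∈ Z_k}` — the closed set whose open complement
`U_k(ℂ) = {x_k ≠ 0}` is the affine piece / Milnor fibre of the tree's `FermatAffineChart` — is:

* `isClosed_fermatSectionPoints` — closed in `Xⁿ⁺¹ₘ(ℂ)`;
* `nonempty_homeomorph_fermatSectionPoints` — homeomorphic to `Xⁿₘ(ℂ)` (the closed immersion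
  `fermatSection : Xⁿₘ ⟶ Xⁿ⁺¹ₘ` is an embedding on complex points with that image);
* `finite_complexPoints_fermat_zero` — for `n = 0`, finite (`X⁰ₘ` is a finite set of closed
  points and complex points are closed points);
* `nonempty_retractionNhds_fermatSectionPoints` — TAUT in `Xⁿ⁺¹ₘ(ℂ)` (a tautness datum in the
  sense of Spanier 1966, Ch. 6 §1 Thm. 10, the tree's `Cech.RetractionNhds`): for `n ≥ 1` it is a
  compact topological manifold, for `n = 0` a finite discrete set, in both cases compact and
  locally contractible inside the closed manifold `Xⁿ⁺¹ₘ(ℂ) ↪ ℝᴺ` (Hatcher Cor. A.9).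

These are the hypotheses under which the tree's Alexander–Lefschetz duality
`H_q(Xⁿ⁺¹ₘ(ℂ), U_k(ℂ)) ≅ Hᵖ(Z_k(ℂ)) ≅ Hᵖ(Xⁿₘ(ℂ))`
(`AlgebraicTopology/SingularHomology/ComplementRelativeHomologyDuality`) applies.

## References

* [Shioda1979HodgeFermat] T. Shioda, The Hodge conjecture for Fermat varieties, Math. Ann. 245
  (1979) 175–184, §1.
* [Ran1980] Z. Ran, Cycles on Fermat hypersurfaces, Compositio Math. 42 (1980), §1 Lemma 1.4.
* [Spanier1981] E. H. Spanier, Algebraic Topology (Springer 1981), Ch. 6 §1 Thm. 10, Cor. 11.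
* [HatcherAT2002] A. Hatcher, Algebraic Topology (CUP 2002), Appendix Thm. A.7, Cor. A.9.
-/

noncomputable section

open CategoryTheory AlgebraicGeometry Topology
open Literature.AlgebraicTopology.SingularHomology Literature.AlgebraicTopology.Homotopy

namespace Literature.AlgebraicGeometry.HodgeTheory

open Literature.AlgebraicGeometry.Motives

variable {n m : ℕ}

/-- **A discrete space is locally contractible** (take the point itself as the small
neighbourhood). [folklore] -/
theorem locallyContractibleSpace_of_discreteTopology {Y : Type*} [TopologicalSpace Y]
    [DiscreteTopology Y] : LocallyContractibleSpace Y := by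
  intro y U hU
  have hyU : y ∈ U := mem_of_mem_nhds hU
  refine ⟨{y}, Set.singleton_subset_iff.mpr hyU, ?_, ⟨⟨y, hyU⟩, ⟨?_⟩⟩⟩
  · exact (isOpen_discrete _).mem_nhds rfl
  · have h : ContinuousMap.inclusion (Set.singleton_subset_iff.mpr hyU) =
        ContinuousMap.const _ (⟨y, hyU⟩ : U) :=
      ContinuousMap.ext fun z ↦ Subtype.ext (Set.mem_singleton_iff.mp z.2)
    exact (ContinuousMap.Homotopy.refl _).cast h.symm rfl

/-- **`Z_k(ℂ) = {P | pt P ∈ Z_k}` is closed in `Xⁿ⁺¹ₘ(ℂ)`** (`Z_k` is Zariski-closed, the image of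
the closed immersion `fermatSection`). [cite: Shioda1979HodgeFermat, §1] -/
theorem isClosed_fermatSectionPoints (hm : m ≠ 0) (k : Fin (n + 3)) :
    IsClosed {P : ComplexPoints (fermatHypersurface (n + 1) m) |
      P.pt ∈ fermatCoordHyperplane (n + 1) m k} := by
  rw [← range_fermatSection hm k]
  exact isClosed_setOf_pt_mem (fermatSection hm k).left.isClosedEmbedding.isClosed_range

/-- **`Z_k(ℂ) ≅ Xⁿₘ(ℂ)`**: the closed immersion `fermatSection : Xⁿₘ ⟶ Xⁿ⁺¹ₘ` is an embedding on
complex points with image `{P | pt P ∈ Z_k}`. [cite: Shioda1979HodgeFermat, §1]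
[cite: Ran1980, §1 Lemma 1.4] -/
theorem nonempty_homeomorph_fermatSectionPoints (hm : m ≠ 0) (k : Fin (n + 3)) :
    Nonempty (ComplexPoints (fermatHypersurface n m) ≃ₜ
      ↥({P : ComplexPoints (fermatHypersurface (n + 1) m) |
        P.pt ∈ fermatCoordHyperplane (n + 1) m k})) := by
  have hemb := AlgPoints.isEmbedding_map_of_isClosedImmersion (L := ℂ) (fermatSection hm k)
  have hrange : Set.range (AlgPoints.map (L := ℂ) (fermatSection hm k)) =
      {P : ComplexPoints (fermatHypersurface (n + 1) m) |
        P.pt ∈ fermatCoordHyperplane (n + 1) m k} := by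
    rw [range_map_eq_setOf_pt_mem_range (L := ℂ) (fermatSection hm k)]
    ext P
    change P.pt ∈ Set.range (fermatSection hm k).left.base ↔ _
    rw [range_fermatSection hm k]
    rfl
  exact ⟨hemb.toHomeomorph.trans (Homeomorph.setCongr hrange)⟩

/-- **`X⁰ₘ(ℂ)` is finite**: complex points of the finite-type `ℂ`-scheme `X⁰ₘ` are closed points
(Nullstellensatz, `ComplexPoints.equivClosedPoints`), and `X⁰ₘ` is a finite scheme
(`finite_fermat_zero`). [folklore] -/
theorem finite_complexPoints_fermat_zero (hm : 1 ≤ m) :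
    Finite (ComplexPoints (fermatHypersurface 0 m)) := by
  haveI := isProper_fermat_hom (m := m) 0
  haveI := finite_fermat_zero hm
  exact Finite.of_injective (fun P ↦ ((ComplexPoints.equivClosedPoints (fermatHypersurface 0 m) P :
      closedPoints (fermatHypersurface 0 m).left) : (fermatHypersurface 0 m).left))
    (fun P Q h ↦ (ComplexPoints.equivClosedPoints (fermatHypersurface 0 m)).injective (Subtype.ext h))

/-- `Z_k(ℂ)` is locally contractible: a compact topological manifold for `n ≥ 1`, a finite
discrete set for `n = 0`. [cite: HatcherAT2002, Cor. A.9 (proof)] -/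
theorem locallyContractibleSpace_fermatSectionPoints (hm : 1 ≤ m) (k : Fin (n + 3)) :
    LocallyContractibleSpace ↥({P : ComplexPoints (fermatHypersurface (n + 1) m) |
      P.pt ∈ fermatCoordHyperplane (n + 1) m k}) := by
  obtain ⟨e⟩ := nonempty_homeomorph_fermatSectionPoints (n := n) (Nat.one_le_iff_ne_zero.mp hm) k
  refine locallyContractibleSpace_of_homeomorph e ?_
  rcases Nat.eq_zero_or_pos n with rfl | hn
  · haveI := finite_complexPoints_fermat_zero hm
    haveI : T2Space (ComplexPoints (fermatHypersurface 0 m)) := by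
      haveI := ComplexPoints.t2Space_of_isSmoothProjective
        (isSmoothProjective_fermatHypersurface (n := 0 + 1) le_rfl hm)
      exact e.symm.t2Space
    haveI : DiscreteTopology (ComplexPoints (fermatHypersurface 0 m)) := inferInstance
    exact locallyContractibleSpace_of_discreteTopology
  · letI := (isSmoothProjective_fermatHypersurface hn hm).chartedSpace
    exact locallyContractibleSpace_of_chartedSpace (EuclideanSpace ℝ (Fin (2 * n)))

/-- **`Z_k(ℂ)` is taut in `Xⁿ⁺¹ₘ(ℂ)`** (a tautness datum, Spanier Thm. 6.1.10 / Cor. 6.1.11): the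
closed manifold `Xⁿ⁺¹ₘ(ℂ)` embeds in some `ℝᴺ` with image a neighbourhood retract (Hatcher
Cor. A.9 with the tree's proved Thm. A.7), and `Z_k(ℂ)` is compact and locally contractible
(`Cech.RetractionNhds.nonempty_of_locallyContractibleSpace`). [cite: Spanier1981, Ch. 6 §1, Thm. 10]
[cite: HatcherAT2002, Thm. A.7 and Cor. A.9] -/
theorem nonempty_retractionNhds_fermatSectionPoints (hm : 1 ≤ m) (k : Fin (n + 3)) :
    Nonempty (Cech.RetractionNhds {P : ComplexPoints (fermatHypersurface (n + 1) m) |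
      P.pt ∈ fermatCoordHyperplane (n + 1) m k}) := by
  have hX : IsSmoothProjective (n + 1) (fermatHypersurface (n + 1) m) :=
    isSmoothProjective_fermatHypersurface (by omega) hm
  letI := hX.chartedSpace
  haveI := ComplexPoints.compactSpace_of_isSmoothProjective hX
  haveI := ComplexPoints.t2Space_of_isSmoothProjective hX
  obtain ⟨N, f, hf⟩ := Literature.Geometry.Manifold.exists_isClosedEmbedding_pi_of_compactSpace
    (M := ComplexPoints (fermatHypersurface (n + 1) m)) (EuclideanSpace ℝ (Fin (2 * (n + 1))))
  have hNR : IsNeighbourhoodRetract (Set.range f) :=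
    isNeighbourhoodRetract_range_of_compactSpace
      isNeighbourhoodRetract_of_locallyContractibleSpace_holds (EuclideanSpace ℝ (Fin (2 * (n + 1))))
      hf.isEmbedding
  exact Cech.RetractionNhds.nonempty_of_locallyContractibleSpace hf.isEmbedding hNR
    (isClosed_fermatSectionPoints (Nat.one_le_iff_ne_zero.mp hm) k).isCompact
    (locallyContractibleSpace_fermatSectionPoints hm k)

end Literature.AlgebraicGeometry.HodgeTheory

end
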